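import Summits.QuantumFields.BalabanUV.Beta.SymGaugeMultiplierBlockMean
import Summits.QuantumFields.BalabanUV.Beta.BorderedHessianResidualDressing

/-!
# `BalabanUV.Beta.SymBorderedHessianResidualDressing` — binder row D1, JSB12SYM-SPINE v1.1 (Σ3) step K2 part c: `resid N ∘ piKSymBm = piKSymBmC`
# (the gauge term `dδd ∘ GamM` of the covariance columns is invisible to `Π̂ᵀ_sym`; pattern `BorderedHessianResidualDressing` verbatim, the support
# set `rowSupp` and the `opM`-linearity BY NAME, K2-b `McolSum_rowSym_eq_zero` for the gauge part)

CHART (RULING R-D1-g25-4): chart (II); hSX separate.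
HONEST FRAMING (cell contract, verbatim): «discharging `BetaPertH` makes Bałaban's UV stability UNCONDITIONAL — a real constructive-QFT
result; it is NOT the continuum limit and NOT the Clay problem.»  THIS MODULE DISCHARGES NOTHING of `BetaPertH` ∕ row D1: [folklore] bookkeeping
of OUR objects.  0 sorry, 0 `def … : Prop`, nothing cited.  NOT HERE (K2 parts d–e): blindness of `bhK` to the symmetrised dressing, the `RelInv`
assembly.  NOT D1, NOT BetaPertH, NOT continuum, NOT Clay.
HONEST DEPENDENCY (verbatim): «continuum YM on T⁴ ⇐ BetaPertH ∧ nine spine estimates (0/9 proved); BetaPertH ⇐ (D1) ∧ (D4) ∧ CAP+tail;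
G-an2-4 gates asym, D1 and NE2/3/4.»  ABSOLUTE RULE (cell, verbatim): «No internally-minted statement may enter as a cited fact. Every
hypothesis is either kernel-proved in this package or a verbatim quotation of a PUBLISHED theorem with page reference.»
Unit `b2b-balaban-beta-an2` gen 25 (row-D1 owner), 2026-08-21.
-/

namespace Summit.QuantumFields.BalabanUV.Beta.SymBorderedHessianResidualDressing

noncomputable section

open Finset
open scoped BigOperators Nat
open Literature.Probability.LatticeModels (TorusSite Torus.proj Torus.proj_apply)
open Literature.MathematicalPhysics.QuantumFieldTheory
open Literature.MathematicalPhysics.QuantumFieldTheory.Balaban1983to89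
open Literature.MathematicalPhysics.QuantumFieldTheory.Balaban1983to89.Beta
open ExpKernelCalculus (MKer comp)
open AffineAveraging (Form0 Form1 Form2 Site box toSite unitVec unitVec_apply dz codiff₁)
open AveragingContoursRooted (ctr ctrOff ctrOff_mem_box)
open KKTFluctuationEnergy (Mcol δcol)
open KernelSpecInstance (opM)
open ResolventComposition (δSum McolSum)
open OneStepResolventKernel (Fib KInv)
open Summit.QuantumFields.BalabanUV.Beta.TameKernelCalculus
open Summit.QuantumFields.BalabanUV.Beta.AxialDressingRooted (cube mem_cube zero_mem_cube tsum_window')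
open Summit.QuantumFields.BalabanUV.Beta.BorderedHessian (resid resid_inl_inl resid_inl_inr resid_inr_inl resid_inr_inr opM_apply rowSupp mem_rowSupp
  sum_rowSupp_eq)
open Summit.QuantumFields.BalabanUV.Beta.SymmetrisedDressingMatrix
open Summit.QuantumFields.BalabanUV.Beta.SymmetrisedDressingKernel
open Summit.QuantumFields.BalabanUV.Beta.SymSliceProjectorRules (piKSymBmC piKSymBmC_inl_inl piKSymBmC_inl_inr piKSymBmC_inr_inl piKSymBmC_inr_inr)
open Summit.QuantumFields.BalabanUV.Beta.SymGaugeMultiplierBlockMean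

variable {d : ℕ} (N : ℕ)

/-! ## §1 The two parts of the field–field window sum -/

/-- [folklore] THE KRONECKER PART of the window sum returns the (windowed) matrix entry of `Π̂ᵀ_sym`. -/
theorem sum_cube_ite_pmSymBm (ρ : Site (d + 1)) (x w : Fin (d + 1) → ℤ) (κ β : Fin (d + 1)) :
    ∑ v ∈ cube (d + 1) N, ∑ l : Fin (d + 1), (if κ = l ∧ x = w - v then (1 : ℝ) else 0) * pmSymBm ρ N β w l (w - v) =
      piKSymBm ρ N x w (Sum.inl κ) (Sum.inl β) := by
  have e : ∀ v, ∑ l : Fin (d + 1), (if κ = l ∧ x = w - v then (1 : ℝ) else 0) * pmSymBm ρ N β w l (w - v) =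
      if v = w - x then pmSymBm ρ N β w κ x else 0 := by
    intro v
    rw [Finset.sum_eq_single κ (fun l _ hl => by rw [if_neg (fun h => hl h.1.symm), zero_mul])
      (fun h => absurd (Finset.mem_univ κ) h)]
    by_cases hv : v = w - x
    · subst hv
      rw [if_pos ⟨rfl, by abel⟩, one_mul, if_pos rfl, sub_sub_cancel]
    · rw [if_neg (fun h => hv (by rw [h.2]; abel)), zero_mul, if_neg hv]
  rw [Finset.sum_congr rfl (fun v _ => e v), Finset.sum_ite_eq', piKSymBm_inl_inl]

/-- [folklore] THE GAUGE PART of the window sum is `dδd` of the gauge multiplier of the covariance field driven by the row `(β, w)` of `Π^{sym}_bm`. -/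
theorem sum_cube_opM_Mcol_sym [NeZero N] (ρ : Site (d + 1)) (x w : Fin (d + 1) → ℤ) (κ β : Fin (d + 1)) :
    ∑ v ∈ cube (d + 1) N, ∑ l : Fin (d + 1), dz (codiff₁ (dz (Mcol (N := N) l (w - v)))) κ x * pmSymBm ρ N β w l (w - v) =
      dz (codiff₁ (dz (McolSum (N := N) (rowSupp N w) (fun b => pmSymBm ρ N β w b.1 b.2)))) κ x := by
  have hsum : McolSum (N := N) (rowSupp N w) (fun b => pmSymBm ρ N β w b.1 b.2)
      = ∑ b ∈ rowSupp N w, pmSymBm ρ N β w b.1 b.2 • Mcol (N := N) b.1 b.2 := by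
    funext z
    rw [Finset.sum_apply]
    simp only [McolSum, Pi.smul_apply, smul_eq_mul]
  rw [hsum, ← opM_apply, map_sum, Finset.sum_apply, Finset.sum_apply,
    sum_rowSupp_eq N (fun l z => (opM (pmSymBm ρ N β w l z • Mcol (N := N) l z)) κ x)]
  refine Finset.sum_congr rfl fun v _ => Finset.sum_congr rfl fun l _ => ?_
  rw [map_smul, Pi.smul_apply, Pi.smul_apply, smul_eq_mul, opM_apply, mul_comm]

/-- [folklore] THE FORCE OF THE `rowSupp`-COMBINATION IS THE ROW of `Π^{sym}_bm` (in-block root: the window carries the row, K1a-1 `window_of_pmSymBm_ne_zero`). -/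
theorem δSum_rowSupp_sym (hN : 1 ≤ N) {r : Fin (d + 1) → ℕ} (hr : r ∈ box (d + 1) N) (β : Fin (d + 1)) (w : Fin (d + 1) → ℤ) :
    δSum (rowSupp N w) (fun b => pmSymBm (toSite r) N β w b.1 b.2) = rowSym (toSite r) N β w := by
  classical
  funext μ y
  rw [rowSym_apply]
  unfold ResolventComposition.δSum
  have e : ∀ b ∈ rowSupp N w, pmSymBm (toSite r) N β w b.1 b.2 * δcol b.1 b.2 μ y = if b = (μ, y) then pmSymBm (toSite r) N β w μ y else 0 := by
    intro b _
    unfold KKTFluctuationEnergy.δcol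
    by_cases hb : b = (μ, y)
    · subst hb; simp
    · rw [if_neg hb, if_neg, mul_zero]
      rintro ⟨h1, h2⟩
      exact hb (Prod.ext h1.symm h2.symm)
  rw [Finset.sum_congr rfl e, Finset.sum_ite_eq']
  split_ifs with hmem
  · rfl
  · by_contra hne
    exact hmem ((mem_rowSupp N).2 (window_of_pmSymBm_ne_zero hN hr (Ne.symm hne)))

/-! ## §2 `resid N ∘ piKSymBm = piKSymBmC` and its transpose -/

/-- [folklore] **THE RESIDUAL IS INVISIBLE TO THE SYMMETRISED DRESSING UP TO THE COARSE RESTRICTION**: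
`comp (resid N) (piKSymBm (toSite r) N) = piKSymBmC (toSite r) N` (in-block root). -/
theorem comp_resid_piKSymBm [NeZero N] {r : Fin (d + 1) → ℕ} (hr : r ∈ box (d + 1) N) :
    comp (resid N) (piKSymBm (toSite r) N) = piKSymBmC (d := d) (toSite r) N := by
  have hN : 1 ≤ N := Nat.one_le_iff_ne_zero.mpr (NeZero.ne N)
  funext x w a b
  rcases b with β | β
  · rcases a with κ | κ
    · -- field–field: window sum = gauge part + Kronecker part
      unfold ExpKernelCalculus.comp
      have e : ∀ z, ∑ f : Fib d, resid N x z (Sum.inl κ) f * piKSymBm (toSite r) N z w f (Sum.inl β) =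
          if w - z ∈ cube (d + 1) N then ∑ l : Fin (d + 1), resid N x z (Sum.inl κ) (Sum.inl l) * pmSymBm (toSite r) N β w l z else 0 := by
        intro z
        rw [Fintype.sum_sum_type]
        simp only [resid_inl_inr, zero_mul, Finset.sum_const_zero, add_zero, piKSymBm_inl_inl]
        split_ifs
        · rfl
        · simp
      simp_rw [e]
      rw [tsum_window']
      simp only [resid_inl_inl, add_mul, Finset.sum_add_distrib]
      rw [sum_cube_opM_Mcol_sym, sum_cube_ite_pmSymBm, McolSum_rowSym_eq_zero (toSite r) β w (rowSupp N w) (δSum_rowSupp_sym N hN hr β w),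
        piKSymBmC_inl_inl]
      simp [dz, codiff₁]
    · -- multiplier–field: every term vanishes
      unfold ExpKernelCalculus.comp
      rw [piKSymBmC_inr_inl]
      refine (tsum_congr fun z => ?_).trans tsum_zero
      rw [Fintype.sum_sum_type]
      simp [resid_inr_inl, piKSymBm_inr_inl]
  · rw [comp_piKSymBm_inr]
    rcases a with κ | κ
    · rw [resid_inl_inr, piKSymBmC_inl_inr]
    · rw [resid_inr_inr, piKSymBmC_inr_inr]

/-- [folklore] **TRANSPOSED FORM**: `comp (trK (piKSymBm (toSite r) N)) (trK (resid N)) = trK (piKSymBmC (toSite r) N)`. -/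
theorem comp_trK_piKSymBm_trK_resid [NeZero N] {r : Fin (d + 1) → ℕ} (hr : r ∈ box (d + 1) N) :
    comp (trK (piKSymBm (toSite r) N)) (trK (resid N)) = trK (piKSymBmC (d := d) (toSite r) N) := by
  rw [← trK_comp, comp_resid_piKSymBm N hr]

end

end Summit.QuantumFields.BalabanUV.Beta.SymBorderedHessianResidualDressing
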